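import Literature.NumberTheory.Automorphic.UnitaryCurveCotangentSpectralProjectionConj
import Literature.NumberTheory.Automorphic.UnitaryGroupCohomologicalFormsConjRep
import Literature.NumberTheory.Rogawski1990.CurveCohomologicalSpectrum
import HarnessLib

/-!
# Rank two: the HOLOMORPHIC ⟺ ANTIHOLOMORPHIC symmetry of the curve cohomological-spectrum letters (E1′₂)
# `Rogawski1990.curveCohFinComponentUnique_hol ∕ _antihol` and (E₂) `UnitaryCurveForms.cohIsotypicLine₂_hol ∕ _antihol`

Topic `NumberTheory/Automorphic`; namespace `Literature.NumberTheory.Automorphic.UnitaryCurveForms` (the namespace of the rank-2 cone carriers ★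
`UnitaryCurveCohCotangentForms`).  PROOF FILE: theorems only — no definition, no named fact, no instance, no `sorry`.  Rank-2 SCALAR twin of ★
`UnitaryGroupCohomologicalFormsConjRep` ((E1′)∕(E) hol ⟺ antihol at rank 3, F0P2-p01 (g2)), over the same rank-free tree tools: the conjugate
`σ̄ = repConj σ` of an abstract representation on `W̄ = ConjVec W` (★ `ConjVec.repConj`, irreducible ∕ smooth iff `σ` is), the conjugate `P̄` of a
discrete automorphic `P` (★ `DiscreteAutomorphicRep.conj`), `P̄` has finite component `σ̄` when `P` has finite component `σ` (★
`UnitaryGroup.CotangentForms.hasFinComponent_conj_repConj`, stated for every rank `N`), and the rank-2 conjugation junction ★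
`UnitaryCurveCotangentSpectralProjectionConj` (`toQuotFun ∘ conjFun₂ = star ∘ toQuotFun`, classes `[f̄] = star [f]`).

WHY ([BorelWallach2000, VII 2.10]: complex conjugation exchanges the `(1,0)` and `(0,1)` forms; [Clozel1990, §3.1]: the conjugate of an automorphic
representation).  `f ↦ f̄ = conjFun₂ f` (conjugate-linear, commuting with the finite-adelic right translation ★ `rightRep₂`, ★ `conjFun₂_rightRep₂`)
exchanges `holCotForms₂ … 𝔣` and its `conjFun₂`-image; `P ∋ f̄ ↔ P̄ ∋ f` (`containsFun_conjFun₂_iff`), so `P` is of Hodge type `(0,1)` iff `P̄` is of type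
`(1,0)` (`isAntiholCotangentAt₂_iff_conj`); and `ψ ↦ ψ̄ := conjFun₂ ∘ ψ ∘ toConj⁻¹` is a bijection, conjugate-linear in the scalar, between the `σ`-equivariant
maps `W → (U(H)(𝔸_{L⁺}) → ℂ)` with antiholomorphic values in `P` and the `σ̄`-equivariant maps `W̄ → …` with holomorphic values in `P̄`.  Hence
**(E1′₂-hol) ⟺ (E1′₂-antihol)** and **(E₂-hol) ⟺ (E₂-antihol)**: four rank-2 named facts are two debts.  CONSUMER: the `n = 2` slice of the sub-sub-line
`Summits/…/Cruxes/HLiu418/Lines/F0_AlbCmS1Betti.lean` (floor-0 programme P5 of the Hodge-CM cell; F0P5-p03 (g0)'s `stub_L10_of_letters` ∕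
`stub_L01_of_letters` take the seven letters E1, E1′₂-hol∕antihol, (D₂)-hol∕antihol, E₂-hol∕antihol as hypotheses): with this file and ★
`UnitaryCurveCotangentSpectralProjectionConj` the three antiholomorphic letters are consequences of the holomorphic ones.  HC_CM is proved only modulo
the printed citations until rung 0 closes; this file discharges none of them.

* §1 `containsFun_conjFun₂_iff`, `conjFun₂_eq_zero_iff`, `conjFun₂_conjFun₂`, `isAntiholCotangentAt₂_iff_conj`, `isHolCotangentAt₂_iff_conj`;
* §2 the conjugation of maps `ψ ↦ conjFun₂ ∘ ψ ∘ toConj⁻¹` and back (written as explicit composites — no new definition): inverse identities,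
  conjugate-linearity in the scalar, transport of `σ`-equivariance to `σ̄`-equivariance;
* §3 `curveCohFinComponentUnique_antihol_of_hol ∕ _hol_of_antihol ∕ _hol_iff_antihol`, `cohIsotypicLine₂_antihol_of_hol ∕ _hol_of_antihol ∕
  _hol_iff_antihol`.

## References
* [BorelWallach2000] A. Borel, N. Wallach, *Continuous cohomology, discrete subgroups, and representations of reductive groups*, 2nd ed. (2000), VII 2.10,
  3.2.
* [BorelJacquet1979] A. Borel, H. Jacquet, Corvallis PSPM 33.1 (1979), §4.6.
* [Clozel1990] L. Clozel, *Motifs et formes automorphes*, in: Automorphic forms, Shimura varieties, and L-functions I (1990), §3.1.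
* [Bump1997] D. Bump, *Automorphic forms and representations* (1997), §4.2 (twisting; irreducibility under equivalences).
-/

noncomputable section

open MeasureTheory NumberField NumberField.InfinitePlace
open scoped Matrix ComplexOrder

namespace Literature.NumberTheory.Automorphic.UnitaryCurveForms

open Literature.NumberTheory.Automorphic.ConjVec
open Literature.NumberTheory.Automorphic.UnitaryGroup
open Literature.NumberTheory.Automorphic.UnitaryGroup.CotangentForms (toQuotFun hasFinComponent_conj_repConj)

/-! ## §1 Junction: `P ∋ f̄ ↔ P̄ ∋ f`; Hodge types `(0,1)` of `P` ↔ `(1,0)` of `P̄` -/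

section Junction

variable {F E : Type} [Field F] [NumberField F] [Field E] [NumberField E] [Algebra F E] {c : E ≃ₐ[F] E}
  {J : Matrix (Fin 2) (Fin 2) E}

/-- `f̄̄ = f`. [cite: BorelWallach2000, VII 2.10] -/
theorem conjFun₂_conjFun₂ (f : (adelicGroupData F E c 2 J).Adelic → ℂ) : conjFun₂ F E c J (conjFun₂ F E c J f) = f := by
  funext x
  rw [conjFun₂_apply, conjFun₂_apply, star_star]

/-- `f̄ = 0 ↔ f = 0`. [cite: BorelWallach2000, VII 2.10] -/
theorem conjFun₂_eq_zero_iff (f : (adelicGroupData F E c 2 J).Adelic → ℂ) : conjFun₂ F E c J f = 0 ↔ f = 0 := by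
  constructor
  · intro h
    rw [← conjFun₂_conjFun₂ f, h, map_zero]
  · rintro rfl
    exact map_zero _

variable {μ : Measure (adelicGroupData F E c 2 J).automorphicQuotient}
  [SMulInvariantMeasure (adelicGroupData F E c 2 J).Adelic (adelicGroupData F E c 2 J).automorphicQuotient μ]

/-- **`P` contains `f̄` iff `P̄` contains `f`** (the class of `f̄` is the conjugate of the class of `f`, ★ `toLp_toQuotFun_conjFun₂`; `g ∈ P̄ ↔ ḡ ∈ P`, ★
`DiscreteAutomorphicRep.mem_conj_space_iff`).  Scalar twin of ★ `CotangentForms.containsForm_conjFun_iff`. [cite: BorelJacquet1979, §4.6] -/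
theorem containsFun_conjFun₂_iff (P : DiscreteAutomorphicRep (adelicGroupData F E c 2 J) μ) (f : (adelicGroupData F E c 2 J).Adelic → ℂ) :
    P.ContainsFun (conjFun₂ F E c J f) ↔ P.conj.ContainsFun f := by
  constructor
  · rintro ⟨hm, hmem⟩
    have hm' : MemLp (toQuotFun (adelicGroupData F E c 2 J) f) 2 μ := (memLp_toQuotFun_conjFun₂_iff c J f).mp hm
    refine ⟨hm', (P.mem_conj_space_iff).mpr ?_⟩
    rw [← toLp_toQuotFun_conjFun₂ c J f hm' hm]
    exact hmem
  · rintro ⟨hm', hmem⟩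
    have hm : MemLp (toQuotFun (adelicGroupData F E c 2 J) (conjFun₂ F E c J f)) 2 μ := (memLp_toQuotFun_conjFun₂_iff c J f).mpr hm'
    refine ⟨hm, ?_⟩
    rw [toLp_toQuotFun_conjFun₂ c J f hm' hm]
    exact (P.mem_conj_space_iff).mp hmem

variable (hc : c ≠ 1) (hfix : ∀ w : InfinitePlace E, c • w = w) (w₁ : {w : InfinitePlace E // IsComplex w})

/-- **`P` is of Hodge type `(0,1)` iff `P̄` is of Hodge type `(1,0)`** (at the place `w₁`, read on the cone frame `𝔣`): a non-zero antiholomorphic form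
`f̄ ∈ P` is the conjugate of a non-zero holomorphic form `f ∈ P̄`.  Scalar twin of ★ `CotangentForms.isAntiholCotangentAt_iff_conj`.
[cite: BorelWallach2000, VII 2.10, 3.2] -/
theorem isAntiholCotangentAt₂_iff_conj (P : DiscreteAutomorphicRep (adelicGroupData F E c 2 J) μ) (𝔣 : ConeFrame E J w₁) :
    P.IsAntiholCotangentAt₂ hc hfix w₁ 𝔣 ↔ P.conj.IsHolCotangentAt₂ hc hfix w₁ 𝔣 := by
  constructor
  · rintro ⟨f, hfmem, hf0, hfP⟩
    obtain ⟨f₀, hf₀, rfl⟩ := Submodule.mem_map.mp hfmem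
    exact ⟨f₀, hf₀, fun h => hf0 (by rw [h, map_zero]), (containsFun_conjFun₂_iff P f₀).mp hfP⟩
  · rintro ⟨f₀, hf₀, hf₀0, hf₀P⟩
    exact ⟨conjFun₂ F E c J f₀, Submodule.mem_map_of_mem hf₀, fun h => hf₀0 ((conjFun₂_eq_zero_iff f₀).mp h),
      (containsFun_conjFun₂_iff P f₀).mpr hf₀P⟩

/-- **`P` is of Hodge type `(1,0)` iff `P̄` is of Hodge type `(0,1)`** (`P̄̄ = P`). [cite: BorelWallach2000, VII 2.10, 3.2] -/
theorem isHolCotangentAt₂_iff_conj (P : DiscreteAutomorphicRep (adelicGroupData F E c 2 J) μ) (𝔣 : ConeFrame E J w₁) :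
    P.IsHolCotangentAt₂ hc hfix w₁ 𝔣 ↔ P.conj.IsAntiholCotangentAt₂ hc hfix w₁ 𝔣 := by
  rw [isAntiholCotangentAt₂_iff_conj hc hfix w₁ P.conj 𝔣, DiscreteAutomorphicRep.conj_conj]

end Junction

/-! ## §2 Conjugating maps `ψ : W → (U(J)(𝔸_F) → ℂ)`: `ψ̄ := conjFun₂ ∘ ψ ∘ toConj⁻¹` and back (explicit composites, no new definition) -/

section Maps

variable {F E : Type} [Field F] [NumberField F] [Field E] [NumberField E] [Algebra F E] {c : E ≃ₐ[F] E}
  {J : Matrix (Fin 2) (Fin 2) E} {W : Type} [AddCommGroup W] [Module ℂ W]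

/-- Unfolding of the conjugated map `ψ̄ = conjFun₂ ∘ ψ ∘ toConj⁻¹`. [cite: BorelWallach2000, VII 2.10] -/
theorem conjFun₂_comp_comp_symm_apply (ψ : W →ₗ[ℂ] ((adelicGroupData F E c 2 J).Adelic → ℂ)) (w : ConjVec W) :
    ((conjFun₂ F E c J).comp (ψ.comp ((toConj (V := W)).symm : ConjVec W →ₛₗ[starRingEnd ℂ] W))) w =
      conjFun₂ F E c J (ψ ((toConj (V := W)).symm w)) := rfl

/-- Unfolding of the un-conjugated map `conjFun₂ ∘ ψ′ ∘ toConj`. [cite: BorelWallach2000, VII 2.10] -/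
theorem conjFun₂_comp_comp_apply (ψ' : ConjVec W →ₗ[ℂ] ((adelicGroupData F E c 2 J).Adelic → ℂ)) (w : W) :
    ((conjFun₂ F E c J).comp (ψ'.comp ((toConj (V := W)) : W →ₛₗ[starRingEnd ℂ] ConjVec W))) w = conjFun₂ F E c J (ψ' (toConj w)) := rfl

/-- Un-conjugating the conjugate gives back `ψ`. [cite: BorelWallach2000, VII 2.10] -/
theorem conjFun₂_comp_comp_conj (ψ : W →ₗ[ℂ] ((adelicGroupData F E c 2 J).Adelic → ℂ)) :
    (conjFun₂ F E c J).comp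
        (((conjFun₂ F E c J).comp (ψ.comp ((toConj (V := W)).symm : ConjVec W →ₛₗ[starRingEnd ℂ] W))).comp
          ((toConj (V := W)) : W →ₛₗ[starRingEnd ℂ] ConjVec W)) = ψ := by
  refine LinearMap.ext fun w => ?_
  rw [conjFun₂_comp_comp_apply, conjFun₂_comp_comp_symm_apply, conjFun₂_conjFun₂]
  -- `toConj.symm (toConj w) = w`
  exact congrArg ψ ((toConj (V := W)).symm_apply_apply w)

/-- Un-conjugation is conjugate-linear in the scalar: `unconj (r • ψ′) = r̄ • unconj ψ′`. [cite: BorelWallach2000, VII 2.10] -/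
theorem conjFun₂_comp_comp_smul (r : ℂ) (ψ' : ConjVec W →ₗ[ℂ] ((adelicGroupData F E c 2 J).Adelic → ℂ)) :
    (conjFun₂ F E c J).comp ((r • ψ').comp ((toConj (V := W)) : W →ₛₗ[starRingEnd ℂ] ConjVec W)) =
      starRingEnd ℂ r • (conjFun₂ F E c J).comp (ψ'.comp ((toConj (V := W)) : W →ₛₗ[starRingEnd ℂ] ConjVec W)) := by
  refine LinearMap.ext fun w => ?_
  rw [LinearMap.smul_apply, conjFun₂_comp_comp_apply, LinearMap.comp_apply, LinearMap.comp_apply, LinearMap.smul_apply,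
    LinearMap.map_smulₛₗ]
  rfl

/-- **`ψ̄` is `σ̄`-equivariant when `ψ` is `σ`-equivariant** (finite-adelic right translation ★ `rightRep₂`; ★ `conjFun₂_rightRep₂`).
[cite: BorelJacquet1979, §4.6] -/
theorem conj_equivariant {σ : Representation ℂ (finAdelic F E c 2 J) W} {ψ : W →ₗ[ℂ] ((adelicGroupData F E c 2 J).Adelic → ℂ)}
    (hψ : ∀ (g : finAdelic F E c 2 J) (w : W), ψ (σ g w) = rightRep₂ F E c J g (ψ w)) (g : finAdelic F E c 2 J) (w : ConjVec W) :
    ((conjFun₂ F E c J).comp (ψ.comp ((toConj (V := W)).symm : ConjVec W →ₛₗ[starRingEnd ℂ] W))) (repConj σ g w) =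
      rightRep₂ F E c J g (((conjFun₂ F E c J).comp (ψ.comp ((toConj (V := W)).symm : ConjVec W →ₛₗ[starRingEnd ℂ] W))) w) := by
  rw [conjFun₂_comp_comp_symm_apply, conjFun₂_comp_comp_symm_apply, repConj_apply, LinearEquiv.symm_apply_apply, hψ,
    conjFun₂_rightRep₂]

end Maps

/-! ## §3 The letters: (E1′₂) and (E₂), holomorphic ⟺ antiholomorphic -/

/-- **(E1′₂-hol) ⟹ (E1′₂-antihol): at most one ANTIholomorphic-type discrete `P` with a given finite component (rank 2), from the holomorphic statement**
applied to the conjugates `P̄, P̄′` (holomorphic type, `isAntiholCotangentAt₂_iff_conj`) and `σ̄` (★ `hasFinComponent_conj_repConj`); `P ↦ P̄` is injective.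
[cite: BorelWallach2000, VII 2.10, 3.2] [cite: Clozel1990, §3.1] -/
theorem curveCohFinComponentUnique_antihol_of_hol (h : Rogawski1990.curveCohFinComponentUnique_hol) :
    Rogawski1990.curveCohFinComponentUnique_antihol := by
  intro L _ _ _ ι H dV hdV hdV0 t ht g hg hsig hpos h4 𝔣 μ _ W _ _ σ hirr hsm P P' hP hP' hf hf'
  have key := h L ι H dV hdV hdV0 t ht g hg hsig hpos h4 𝔣 μ (ConjVec W) (repConj σ) ((isIrreducible_repConj_iff σ).mpr hirr)
    ((isSmooth_repConj_iff σ).mpr hsm) P.conj P'.conj ((isAntiholCotangentAt₂_iff_conj _ _ _ P 𝔣).mp hP)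
    ((isAntiholCotangentAt₂_iff_conj _ _ _ P' 𝔣).mp hP') (hasFinComponent_conj_repConj P hf) (hasFinComponent_conj_repConj P' hf')
  rw [← P.conj_conj, key, P'.conj_conj]

/-- **(E1′₂-antihol) ⟹ (E1′₂-hol)**, by the same conjugation (`isHolCotangentAt₂_iff_conj`). [cite: BorelWallach2000, VII 2.10, 3.2] [cite: Clozel1990, §3.1] -/
theorem curveCohFinComponentUnique_hol_of_antihol (h : Rogawski1990.curveCohFinComponentUnique_antihol) :
    Rogawski1990.curveCohFinComponentUnique_hol := by
  intro L _ _ _ ι H dV hdV hdV0 t ht g hg hsig hpos h4 𝔣 μ _ W _ _ σ hirr hsm P P' hP hP' hf hf'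
  have key := h L ι H dV hdV hdV0 t ht g hg hsig hpos h4 𝔣 μ (ConjVec W) (repConj σ) ((isIrreducible_repConj_iff σ).mpr hirr)
    ((isSmooth_repConj_iff σ).mpr hsm) P.conj P'.conj ((isHolCotangentAt₂_iff_conj _ _ _ P 𝔣).mp hP)
    ((isHolCotangentAt₂_iff_conj _ _ _ P' 𝔣).mp hP') (hasFinComponent_conj_repConj P hf) (hasFinComponent_conj_repConj P' hf')
  rw [← P.conj_conj, key, P'.conj_conj]

/-- **(E1′₂-hol) ⟺ (E1′₂-antihol).** [cite: BorelWallach2000, VII 2.10, 3.2] [cite: Clozel1990, §3.1] -/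
theorem curveCohFinComponentUnique_hol_iff_antihol :
    Rogawski1990.curveCohFinComponentUnique_hol ↔ Rogawski1990.curveCohFinComponentUnique_antihol :=
  ⟨curveCohFinComponentUnique_antihol_of_hol, curveCohFinComponentUnique_hol_of_antihol⟩

/-- **(E₂-hol) ⟹ (E₂-antihol): the antiholomorphic cotangent isotypic line of `P` from the holomorphic line of `P̄`.**  For `ψ : σ → (antihol forms in P)`
equivariant, `ψ̄ = conjFun₂ ∘ ψ ∘ toConj⁻¹ : σ̄ → (hol forms in P̄)` is equivariant (`conj_equivariant`, `containsFun_conjFun₂_iff`), so `ψ̄ = r • ψ̄₀` by (E₂-hol) at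
`(σ̄, P̄)`, whence `ψ = r̄ • (conjFun₂ ∘ ψ̄₀ ∘ toConj)`. [cite: BorelWallach2000, VII 2.10, 3.2] [cite: Clozel1990, §3.1] -/
theorem cohIsotypicLine₂_antihol_of_hol (h : cohIsotypicLine₂_hol) : cohIsotypicLine₂_antihol := by
  intro L _ _ _ ι H dV hdV hdV0 t ht g hg hsig hpos h4 𝔣 μ _ W _ _ σ hirr hsm P
  obtain ⟨ψ₀', hψ₀'⟩ := h L ι H dV hdV hdV0 t ht g hg hsig hpos h4 𝔣 μ (ConjVec W) (repConj σ) ((isIrreducible_repConj_iff σ).mpr hirr)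
    ((isSmooth_repConj_iff σ).mpr hsm) P.conj
  refine ⟨(conjFun₂ (↥(maximalRealSubfield L)) L (IsCMField.complexConj L) H).comp
      (ψ₀'.comp ((toConj (V := W)) : W →ₛₗ[starRingEnd ℂ] ConjVec W)), fun ψ hψσ hψval => ?_⟩
  obtain ⟨r, hr⟩ := hψ₀' ((conjFun₂ (↥(maximalRealSubfield L)) L (IsCMField.complexConj L) H).comp
      (ψ.comp ((toConj (V := W)).symm : ConjVec W →ₛₗ[starRingEnd ℂ] W))) (conj_equivariant hψσ) (fun w => by
    obtain ⟨hmem, hcont⟩ := hψval ((toConj (V := W)).symm w)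
    obtain ⟨f₀, hf₀, hf₀eq⟩ := Submodule.mem_map.mp hmem
    refine ⟨?_, ?_⟩
    · rw [conjFun₂_comp_comp_symm_apply, ← hf₀eq, conjFun₂_conjFun₂]
      exact hf₀
    · rw [conjFun₂_comp_comp_symm_apply, containsFun_conjFun₂_iff, DiscreteAutomorphicRep.conj_conj]
      exact hcont)
  refine ⟨starRingEnd ℂ r, ?_⟩
  rw [← conjFun₂_comp_comp_conj ψ, hr, conjFun₂_comp_comp_smul]

/-- **(E₂-antihol) ⟹ (E₂-hol)**, by the same conjugation. [cite: BorelWallach2000, VII 2.10, 3.2] [cite: Clozel1990, §3.1] -/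
theorem cohIsotypicLine₂_hol_of_antihol (h : cohIsotypicLine₂_antihol) : cohIsotypicLine₂_hol := by
  intro L _ _ _ ι H dV hdV hdV0 t ht g hg hsig hpos h4 𝔣 μ _ W _ _ σ hirr hsm P
  obtain ⟨ψ₀', hψ₀'⟩ := h L ι H dV hdV hdV0 t ht g hg hsig hpos h4 𝔣 μ (ConjVec W) (repConj σ) ((isIrreducible_repConj_iff σ).mpr hirr)
    ((isSmooth_repConj_iff σ).mpr hsm) P.conj
  refine ⟨(conjFun₂ (↥(maximalRealSubfield L)) L (IsCMField.complexConj L) H).comp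
      (ψ₀'.comp ((toConj (V := W)) : W →ₛₗ[starRingEnd ℂ] ConjVec W)), fun ψ hψσ hψval => ?_⟩
  obtain ⟨r, hr⟩ := hψ₀' ((conjFun₂ (↥(maximalRealSubfield L)) L (IsCMField.complexConj L) H).comp
      (ψ.comp ((toConj (V := W)).symm : ConjVec W →ₛₗ[starRingEnd ℂ] W))) (conj_equivariant hψσ) (fun w => by
    obtain ⟨hmem, hcont⟩ := hψval ((toConj (V := W)).symm w)
    refine ⟨?_, ?_⟩
    · rw [conjFun₂_comp_comp_symm_apply]
      exact Submodule.mem_map_of_mem hmem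
    · rw [conjFun₂_comp_comp_symm_apply, containsFun_conjFun₂_iff, DiscreteAutomorphicRep.conj_conj]
      exact hcont)
  refine ⟨starRingEnd ℂ r, ?_⟩
  rw [← conjFun₂_comp_comp_conj ψ, hr, conjFun₂_comp_comp_smul]

/-- **(E₂-hol) ⟺ (E₂-antihol).** [cite: BorelWallach2000, VII 2.10, 3.2] [cite: Clozel1990, §3.1] -/
theorem cohIsotypicLine₂_hol_iff_antihol : cohIsotypicLine₂_hol ↔ cohIsotypicLine₂_antihol :=
  ⟨cohIsotypicLine₂_antihol_of_hol, cohIsotypicLine₂_hol_of_antihol⟩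

end Literature.NumberTheory.Automorphic.UnitaryCurveForms

end
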